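import Summits.NavierStokesRegularity.NavierStokesRegularity.Theses.PalasekTowerBreakdown
import Summits.NavierStokesRegularity.FluidComputer.PalasekTowerRegisterGlobalExactSliceEpisode
import Summits.NavierStokesRegularity.FluidComputer.PalasekTowerGermHostExplicit

/-!
# NavierStokesRegularity — route `PalasekTowerBreakdown`, crux `EpisodeBase`: the EXACT-SLICE form by name —
# `EpisodeBase` ⇔ a prepared host and ONE run from its slice `u(τ₀)` over the first growth window

Supports `stmt-NavierStokesRegularity-19179` (`PalasekTowerBreakdown.EpisodeBase`, unfolding to K1G
`EpisodeBaseG` = `RungG 1`; it does NOT close it). Cell `ns-blowup`, seat `ns-blowup-ecbridge-4` (g5; stub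
`first_episode`), D-0074 GROUP C «BRIDGE SUPPORT». LABEL: E–C typing (pure glue over the landed register
theorems of `FluidComputer/PalasekTowerRegisterGlobalExactSlice{,Episode}.lean`: a bounded finite-energy
classical run from a registered stage's slice under the window force IS a continuation — F2 with force
`Stage.exists_continuation_past`, forced Serrin–Masuda `velocity_eq_of_bounded_classical_Icc`, pressure
re-gauge, glue). WHAT THIS IS NOT: not NS — no stage, flow or tower is constructed here; every theorem below
has as hypothesis ONE classical forced Navier–Stokes flow on the first growth window with the level-`1`
readouts, or states an equivalence; nothing is asserted about whether such a flow exists.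

* `palasekTowerBreakdown_episodeBase_iff_exists_sliceRun` — `EpisodeBase ↔` some pinned (`Λ = 8`, `θ = 6/5`),
  rigid, quiet design on the wide-base rates with a registered host `s` (globally anchored level-`0` stage)
  and ONE classical finite-energy solution of the design's system on `[τ₀, τ₁]` FROM THE SLICE `s.u τ₀`, below
  `(5/3) Y₁`, showing the level-`1` letter at `τ₁` (speed `≥ Y₁`, gradient `≥ A₁`, `N₁`-core, in the ball).
  Compare the doors of record: `…_iff_exists_exact` (two children over a singleton class),
  `…_of_heredityWitness_zero` (datum form: re-run from `t = 0`), ecbridge-6's window form (restart at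
  `τ₀ − ε`): here `ε = 0` and the push on the window is the design's own.
* `palasekTowerBreakdown_episodeBase_of_pushed_sliceRun` — the same with an admissible RE-PUSH `g` chosen after
  seeing the host (`= S.f` on `[0, τ₀]`, silent from `τ₁`, confined, `‖g‖ ≤ c Y_k`, `c ≤ 1`).
* `palasekTowerBreakdown_episodeBase_of_lineGerm_sliceRun` — for the EXPLICIT germ designs of seat ecbridge-3
  (`Germ.LineGermData U ρ σ₀ ε c₄`; the strict tiny design `strictTinySchedule` is one, `Germ.schedule_eq`):
  the slice at `τ₀ = 1` IS THE PROFILE `U` (`Germ.lineVel_one`), so the crux follows from ONE classical run of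
  Navier–Stokes at unit viscosity on `[1, 1 + w₀]` forced by `lineForce U σ₀ ε` (the faded residual, zero from
  `1 + ε` on) STARTING FROM `U`, finite energy, below `(5/3) Y₁`, with the level-`1` letter at `1 + w₀` in
  `B̄(0, ρ)` — the `ε = 0` sharpening of `palasekTowerBreakdown_episodeBase_of_lineGerm_window` (restart from
  `U + σline σ₀ (1 − δ) • V` at `1 − δ`); `palasekTowerBreakdown_episodeBase_of_levelZeroData_sliceRun` —
  the same for ANY profile `U` of the kernel slot `Germ.LevelZeroData U ρ` (its germ schedule). This is the
  statement a certified window integration targets.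
* `palasekTowerBreakdown_exists_slot_pushed_levelWitness_of_sliceRun` /
  `palasekTowerBreakdown_exists_slot_levelWitness_of_sliceRun` — THE REGISTERED STUB of the v4 line `slot`
  (`stub_slot_pushed_levelWitness`, holder `ns-palasek-19179-p2`; nested `∃`: strict-slot filler, push constant,
  admissible re-push, LEVEL WITNESS of the re-pushed germ schedule — DATUM form), resp. its unpushed form, FROM ONE
  SLICE RUN starting at `U` on `[1, 1 + w₀]`: the slice-run certificate feeds the registered stub's statement verbatim
  (then `palasekTowerBreakdown_episodeBase_of_exists_slot_pushed_levelWitness`, p465542, closes the crux by name).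

HONEST NOTE: the mathematics of the first episode is untouched (speed `Y₀ ≈ 1351 → Y₁ ≈ 2778`, gradient
`A₁ ≈ 1.24·10⁶`, `N₁`-core, inside `w₀ ≈ 1.8·10⁻⁴` at unit viscosity, by the designed flow's own dynamics).

References: S. Palasek, arXiv:2605.13827 §4 [cite: Palasek2026ElementaryModel, §4]; H. Sohr, *The
Navier–Stokes Equations* (2001), Ch. V Thm. 1.5.1 [cite: Sohr2001, Ch. V Thm. 1.5.1].
-/

noncomputable section

-- `Summit.<Summit>.<Problem>` is the tree's mandated summit-side namespace (CONVENTIONS §2); for this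
-- single-conjunct summit the two coincide, so the duplicate is deliberate.
set_option linter.dupNamespace false

namespace Summit.NavierStokesRegularity.NavierStokesRegularity.Theorems

open Set Function MeasureTheory
open scoped ENNReal
open Summit.NavierStokesRegularity.NavierStokesRegularity.Theses
open Summit.NavierStokesRegularity.FluidComputer.PalasekTowerClayBridge
open Summit.NavierStokesRegularity.FluidComputer.PalasekTowerClayBridge.Germ
open Literature.Analysis.FluidPDE

/-- **`EpisodeBase` ⇔ a prepared host and ONE SLICE RUN, by name** (`ε = 0`, no re-push): the crux iff some
pinned (`Λ = 8`, `θ = 6/5`), rigid, quiet design on the wide-base rates with a globally anchored registered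
level-`0` stage `s` launches from its slice `s.u τ₀` a classical finite-energy solution of its own (forced)
system on `[τ₀, τ₁]`, below `c₂ Y₁ = (5/3) Y₁`, with the level-`1` letter at `τ₁`
(`episodeBaseG_iff_exists_sliceRun_zero`). [cite: Palasek2026ElementaryModel, §4] [cite: Sohr2001, Ch. V Thm. 1.5.1] -/
theorem palasekTowerBreakdown_episodeBase_iff_exists_sliceRun :
    PalasekTowerBreakdown.EpisodeBase ↔ ∃ S : Schedule TowerRates.wide, S.Pins 8 (6 / 5) ∧ S.Rigid ∧ S.Quiet ∧
      ∃ s : Stage 1 TowerRates.wide S (Margins.routeG TowerRates.wide) 0,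
        ∃ (v : ℝ → EuclideanSpace ℝ (Fin 3) → EuclideanSpace ℝ (Fin 3))
          (q : ℝ → EuclideanSpace ℝ (Fin 3) → ℝ),
          IsClassicalNSSolutionOn (Icc (S.τ 0) (S.τ 1)) 1 S.f v q ∧
          v (S.τ 0) = s.u (S.τ 0) ∧
          (∃ C : ℝ≥0∞, C < ⊤ ∧ ∀ t ∈ Icc (S.τ 0) (S.τ 1), ∫⁻ x, ‖v t x‖ₑ ^ 2 ≤ C) ∧
          (∀ t ∈ Icc (S.τ 0) (S.τ 1), ∀ x, ‖v t x‖ ≤ S.c₂ * TowerRates.wide.Y 1) ∧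
          Letter S 1 (v (S.τ 1)) := by
  unfold PalasekTowerBreakdown.EpisodeBase
  exact episodeBaseG_iff_exists_sliceRun_zero

/-- **`EpisodeBase` from a host and one slice run under an admissible RE-PUSH, by name**: a pinned rigid
design `S` with a registered host `s₀`, a push constant `c ≤ c₁` and an admissible push `g` (Clay class,
`= S.f` on `[0, τ₀]`, silent from `τ₁`, confined to the ball, `‖g‖ ≤ c Y_k` on the windows), and ONE
classical finite-energy solution of Navier–Stokes at unit viscosity forced by `g` on `[τ₀, τ₁]` from the
slice `s₀.u τ₀`, below `c₂ Y₁`, with the level-`1` letter at `τ₁` ⟹ the crux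
(`firstEpisodeD_exact_of_sliceRun` + the split glue `episodeBaseG_of_exact`). [cite: Palasek2026ElementaryModel, §4] -/
theorem palasekTowerBreakdown_episodeBase_of_pushed_sliceRun {S : Schedule TowerRates.wide}
    (hP : S.Pins 8 (6 / 5)) (hR : S.Rigid) (hQ : S.Quiet)
    (s₀ : Stage 1 TowerRates.wide S (Margins.routeG TowerRates.wide) 0)
    {c : ℝ} (hc : c ≤ S.c₁) {g : ℝ → EuclideanSpace ℝ (Fin 3) → EuclideanSpace ℝ (Fin 3)}
    (h₁ : IsSmoothOnHalfSpace g) (h₂ : HasRapidSpaceTimeDecay g) (h₃ : ∀ t, S.T ≤ t → ∀ x, g t x = 0)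
    (h₄ : ∀ k, ∀ t ∈ Icc (S.τ k) (S.τ (k + 1)), ∀ x, ‖g t x‖ ≤ c * TowerRates.wide.Y k)
    (hg : ∀ t ∈ Icc 0 (S.τ 0), ∀ x, g t x = S.f t x) (hsilent : ∀ t, S.τ 1 ≤ t → g t = 0)
    (hconf : ∀ t x, S.radius < ‖x‖ → g t x = 0)
    {v : ℝ → EuclideanSpace ℝ (Fin 3) → EuclideanSpace ℝ (Fin 3)} {q : ℝ → EuclideanSpace ℝ (Fin 3) → ℝ}
    (hv : IsClassicalNSSolutionOn (Icc (S.τ 0) (S.τ 1)) 1 g v q) (hv0 : v (S.τ 0) = s₀.u (S.τ 0))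
    (hEv : ∃ C : ℝ≥0∞, C < ⊤ ∧ ∀ t ∈ Icc (S.τ 0) (S.τ 1), ∫⁻ x, ‖v t x‖ₑ ^ 2 ≤ C)
    (hceil : ∀ t ∈ Icc (S.τ 0) (S.τ 1), ∀ x, ‖v t x‖ ≤ S.c₂ * TowerRates.wide.Y 1)
    (hletter : Letter S 1 (v (S.τ 1))) : PalasekTowerBreakdown.EpisodeBase := by
  unfold PalasekTowerBreakdown.EpisodeBase
  exact episodeBaseG_of_exact S ((hostPreparationD_exact_iff S).2 ⟨hP, hR, hQ, ⟨s₀⟩⟩)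
    (firstEpisodeD_exact_of_sliceRun hP hR s₀ hc h₁ h₂ h₃ h₄ hg hsilent hconf hv hv0 hEv hceil hletter)

/-- **`EpisodeBase` from a host and one slice run under the design's own push, by name** (quiet `S`, no
re-push). [cite: Palasek2026ElementaryModel, §4] -/
theorem palasekTowerBreakdown_episodeBase_of_sliceRun {S : Schedule TowerRates.wide}
    (hP : S.Pins 8 (6 / 5)) (hR : S.Rigid) (hQ : S.Quiet)
    (s₀ : Stage 1 TowerRates.wide S (Margins.routeG TowerRates.wide) 0)
    {v : ℝ → EuclideanSpace ℝ (Fin 3) → EuclideanSpace ℝ (Fin 3)} {q : ℝ → EuclideanSpace ℝ (Fin 3) → ℝ}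
    (hv : IsClassicalNSSolutionOn (Icc (S.τ 0) (S.τ 1)) 1 S.f v q) (hv0 : v (S.τ 0) = s₀.u (S.τ 0))
    (hEv : ∃ C : ℝ≥0∞, C < ⊤ ∧ ∀ t ∈ Icc (S.τ 0) (S.τ 1), ∫⁻ x, ‖v t x‖ₑ ^ 2 ≤ C)
    (hceil : ∀ t ∈ Icc (S.τ 0) (S.τ 1), ∀ x, ‖v t x‖ ≤ S.c₂ * TowerRates.wide.Y 1)
    (hletter : Letter S 1 (v (S.τ 1))) : PalasekTowerBreakdown.EpisodeBase := by
  unfold PalasekTowerBreakdown.EpisodeBase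
  exact episodeBaseG_of_exact S ((hostPreparationD_exact_iff S).2 ⟨hP, hR, hQ, ⟨s₀⟩⟩)
    (firstEpisodeD_exact_of_sliceRun_self hP hR hQ s₀ hv hv0 hEv hceil hletter)

variable {U : EuclideanSpace ℝ (Fin 3) → EuclideanSpace ℝ (Fin 3)} {ρ σ₀ ε c₄ : ℝ}

/-- **`EpisodeBase` FROM ONE RUN STARTING AT THE PROFILE `U` OF AN EXPLICIT GERM DESIGN** (`ε = 0` form of
`palasekTowerBreakdown_episodeBase_of_lineGerm_window`): `LineGermData U ρ σ₀ ε c₄` (readouts of `U`, line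
anchor at `σ₀`, residual bound on `[1, 1 + ε]`) and a classical solution `(v, q)` on the first growth window
`[1, 1 + w₀]` (`Host.τfirst = 1 + w₀`) of Navier–Stokes at unit viscosity forced by `lineForce U σ₀ ε`
(`= fade • (NS residual of the line germ)`, zero from `1 + ε` on), STARTING FROM THE PROFILE `v 1 = U` — the
host's slice at `τ₀ = 1` (`Germ.lineVel_one`) — with finite energy, `‖v‖ ≤ (5/3) Y₁` on the window, and at
`t = 1 + w₀`, in `B̄(0, ρ)`: speed `≥ Y₁`, gradient `≥ A₁`, an `N₁`-core loop with circulation `≥ N₁^{β−2}`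
⟹ `EpisodeBase`. [cite: Palasek2026ElementaryModel, §4] [cite: Sohr2001, Ch. V Thm. 1.5.1] -/
theorem palasekTowerBreakdown_episodeBase_of_lineGerm_sliceRun (d : LineGermData U ρ σ₀ ε c₄)
    {v : ℝ → EuclideanSpace ℝ (Fin 3) → EuclideanSpace ℝ (Fin 3)}
    {q : ℝ → EuclideanSpace ℝ (Fin 3) → ℝ}
    (hcl : IsClassicalNSSolutionOn (Icc 1 Host.τfirst) 1 (lineForce U σ₀ ε) v q)
    (h1 : v 1 = U)
    (henergy : ∃ C : ℝ≥0∞, C < ⊤ ∧ ∀ t ∈ Icc (1 : ℝ) Host.τfirst, ∫⁻ x, ‖v t x‖ₑ ^ 2 ≤ C)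
    (hceil : ∀ t ∈ Icc (1 : ℝ) Host.τfirst, ∀ x, ‖v t x‖ ≤ 5 / 3 * TowerRates.wide.Y 1)
    (hfloor : ∃ x, ‖x‖ ≤ ρ ∧ TowerRates.wide.Y 1 ≤ ‖v Host.τfirst x‖)
    (hstrain : ∃ x, ‖x‖ ≤ ρ ∧ TowerRates.wide.A 1 ≤ ‖fderiv ℝ (v Host.τfirst) x‖)
    (hcore : ∃ (x : EuclideanSpace ℝ (Fin 3)) (γ : ℝ → EuclideanSpace ℝ (Fin 3)),
      ‖x‖ ≤ ρ ∧ ContDiff ℝ 1 γ ∧ γ 0 = γ 1 ∧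
      (∀ s ∈ Icc (0 : ℝ) 1, γ s ∈ Metric.closedBall x (1 / TowerRates.wide.N 1)) ∧
      (∀ s ∈ Icc (0 : ℝ) 1, ‖deriv γ s‖ ≤ 8 * Real.pi / TowerRates.wide.N 1) ∧
      TowerRates.wide.N 1 ^ (TowerRates.wide.β - 2) ≤ circulation (v Host.τfirst) γ) :
    PalasekTowerBreakdown.EpisodeBase := by
  obtain ⟨s₀⟩ := d.stage
  have hτ0 : d.schedule.τ 0 = 1 := d.schedule_τ_zero
  -- the host's slice at `τ₀ = 1` is the profile `U` (the stage pins the design's flow: forced Serrin–Masuda)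
  have hslice : s₀.u 1 = U := by
    have h0 : lineVel U σ₀ 0 = d.schedule.u₀ := by rw [lineVel_zero]; rfl
    have key := s₀.velocity_eq_of_classical one_pos (T' := 1) (by rw [hτ0]) d.isClassicalNSSolutionOn_vel
      h0 d.energy_vel
    rw [hτ0] at key
    rw [← key 1 ⟨zero_le_one, le_rfl⟩, lineVel_one]
  refine palasekTowerBreakdown_episodeBase_of_sliceRun d.schedule_pins d.schedule_rigid d.schedule_quiet s₀
    (v := v) (q := q) ?_ ?_ ?_ ?_ ?_
  · show IsClassicalNSSolutionOn (Icc (d.schedule.τ 0) (d.schedule.τ 1)) 1 d.schedule.f v q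
    rw [hτ0, d.schedule_τ_one, d.schedule_f]; exact hcl
  · show v (d.schedule.τ 0) = s₀.u (d.schedule.τ 0)
    rw [hτ0, h1, hslice]
  · show ∃ C : ℝ≥0∞, C < ⊤ ∧ ∀ t ∈ Icc (d.schedule.τ 0) (d.schedule.τ 1), ∫⁻ x, ‖v t x‖ₑ ^ 2 ≤ C
    rw [hτ0, d.schedule_τ_one]; exact henergy
  · show ∀ t ∈ Icc (d.schedule.τ 0) (d.schedule.τ 1), ∀ x, ‖v t x‖ ≤ d.schedule.c₂ * TowerRates.wide.Y 1
    rw [hτ0, d.schedule_τ_one, d.schedule_c₂]; exact hceil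
  · show (∃ x, ‖x‖ ≤ d.schedule.radius ∧
        d.schedule.c₁ * TowerRates.wide.Y 1 ≤ ‖v (d.schedule.τ 1) x‖) ∧
      (∃ x, ‖x‖ ≤ d.schedule.radius ∧
        d.schedule.c₁ * TowerRates.wide.A 1 ≤ ‖fderiv ℝ (v (d.schedule.τ 1)) x‖) ∧
      (∃ (x : EuclideanSpace ℝ (Fin 3)) (γ : ℝ → EuclideanSpace ℝ (Fin 3)),
        ‖x‖ ≤ d.schedule.radius ∧ ContDiff ℝ 1 γ ∧ γ 0 = γ 1 ∧
        (∀ s ∈ Icc (0 : ℝ) 1, γ s ∈ Metric.closedBall x (1 / TowerRates.wide.N 1)) ∧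
        (∀ s ∈ Icc (0 : ℝ) 1, ‖deriv γ s‖ ≤ 8 * Real.pi / TowerRates.wide.N 1) ∧
        d.schedule.c₁ * TowerRates.wide.N 1 ^ (TowerRates.wide.β - 2) ≤
          circulation (v (d.schedule.τ 1)) γ)
    rw [d.schedule_τ_one, d.schedule_radius, d.schedule_c₁, one_mul, one_mul, one_mul]
    exact ⟨hfloor, hstrain, hcore⟩

/-- **THE SLOT FORM: `EpisodeBase` from ONE run starting at ANY profile `U` of the kernel slot
`Germ.LevelZeroData U ρ`** (its germ schedule `h.schedule c₄ …` IS an explicit germ design,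
`Germ.LevelZeroData.schedule_eq`; the named `S⋆ = Germ.strictTinySchedule` of seat ecbridge-3 and every
future slot profile are instances): a classical solution of Navier–Stokes at unit viscosity on `[1, 1 + w₀]`
forced by `lineForce U h.width (h.fadeLen hc₄)` STARTING FROM `U`, finite energy, below `(5/3) Y₁`, with the
level-`1` letter at `1 + w₀` in `B̄(0, ρ)` ⟹ `EpisodeBase`. [cite: Palasek2026ElementaryModel, §4] -/
theorem palasekTowerBreakdown_episodeBase_of_levelZeroData_sliceRun {h : LevelZeroData U ρ} {c₄ : ℝ}
    (hc₄ : 0 < c₄) (hc₄' : c₄ ≤ 1)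
    {v : ℝ → EuclideanSpace ℝ (Fin 3) → EuclideanSpace ℝ (Fin 3)}
    {q : ℝ → EuclideanSpace ℝ (Fin 3) → ℝ}
    (hcl : IsClassicalNSSolutionOn (Icc 1 Host.τfirst) 1 (lineForce U h.width (h.fadeLen hc₄)) v q)
    (h1 : v 1 = U)
    (henergy : ∃ C : ℝ≥0∞, C < ⊤ ∧ ∀ t ∈ Icc (1 : ℝ) Host.τfirst, ∫⁻ x, ‖v t x‖ₑ ^ 2 ≤ C)
    (hceil : ∀ t ∈ Icc (1 : ℝ) Host.τfirst, ∀ x, ‖v t x‖ ≤ 5 / 3 * TowerRates.wide.Y 1)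
    (hfloor : ∃ x, ‖x‖ ≤ ρ ∧ TowerRates.wide.Y 1 ≤ ‖v Host.τfirst x‖)
    (hstrain : ∃ x, ‖x‖ ≤ ρ ∧ TowerRates.wide.A 1 ≤ ‖fderiv ℝ (v Host.τfirst) x‖)
    (hcore : ∃ (x : EuclideanSpace ℝ (Fin 3)) (γ : ℝ → EuclideanSpace ℝ (Fin 3)),
      ‖x‖ ≤ ρ ∧ ContDiff ℝ 1 γ ∧ γ 0 = γ 1 ∧
      (∀ s ∈ Icc (0 : ℝ) 1, γ s ∈ Metric.closedBall x (1 / TowerRates.wide.N 1)) ∧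
      (∀ s ∈ Icc (0 : ℝ) 1, ‖deriv γ s‖ ≤ 8 * Real.pi / TowerRates.wide.N 1) ∧
      TowerRates.wide.N 1 ^ (TowerRates.wide.β - 2) ≤ circulation (v Host.τfirst) γ) :
    PalasekTowerBreakdown.EpisodeBase :=
  palasekTowerBreakdown_episodeBase_of_lineGerm_sliceRun (h.lineGermData hc₄ hc₄') hcl h1 henergy hceil
    hfloor hstrain hcore

/-! ## The REGISTERED STUB of line `slot` (skeleton v4, `stub_slot_pushed_levelWitness`) from ONE slice run

The v4 skeleton of the crux (holder `ns-palasek-19179-p2`, `Cruxes/EpisodeBase/Lines/slot.lean` 6becc362…) registers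
`SlotPushedLevelWitness` = SOME strict-slot filler `U` (`Germ.LevelZeroData U ρ`), SOME `c₄ ∈ (0, 1]`, SOME admissible
re-push `g` of the germ schedule `h.schedule c₄`, and a LEVEL WITNESS at level `0` of the re-pushed schedule (DATUM
form: one classical flow from rest on `[0, τ₁]`). The two theorems below produce that nested existential — verbatim the
hypothesis of `palasekTowerBreakdown_episodeBase_of_exists_slot_pushed_levelWitness` (p465542) — resp. its unpushed
form, from ONE classical run on the WINDOW `[1, 1 + w₀]` STARTING FROM THE PROFILE `U` (the host's history on `[0, 1]`
is the closed-form line germ and is glued on by `Stage.levelWitness_of_sliceRun`; nothing before `τ₀ = 1` is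
re-integrated). -/

/-- **The registered stub's statement from ONE PUSHED SLICE RUN**: a strict-slot filler `h : Germ.LevelZeroData U ρ`,
`c₄ ∈ (0, 1]`, an admissible re-push `g` of its germ schedule `S = h.schedule c₄ …` (`c ≤ c₁`, Clay class, silent from
`T`, `‖g‖ ≤ c Y_k` on the windows, `= S.f` on `[0, τ₀]`, confined to `B̄(0, ρ)`, zero from `τ₁ = Host.τfirst` on) and ONE
classical finite-energy solution `(v, q)` of Navier–Stokes at unit viscosity forced by `g` on `[1, Host.τfirst]` with
`v 1 = U`, below `(5/3) Y₁`, with the level-`1` letter at `Host.τfirst` in `B̄(0, ρ)` ⟹ the nested existential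
registered as `stub_slot_pushed_levelWitness` (a pushed level witness of a strict-slot filler's germ schedule).
[cite: Palasek2026ElementaryModel, §4] [cite: Sohr2001, Ch. V Thm. 1.5.1] -/
theorem palasekTowerBreakdown_exists_slot_pushed_levelWitness_of_sliceRun (h : LevelZeroData U ρ) {c₄ : ℝ}
    (hc₄ : 0 < c₄) (hc₄' : c₄ ≤ 1) {c : ℝ} (hc : c ≤ (h.schedule c₄ hc₄ hc₄').c₁)
    {g : ℝ → EuclideanSpace ℝ (Fin 3) → EuclideanSpace ℝ (Fin 3)}
    (h₁ : IsSmoothOnHalfSpace g) (h₂ : HasRapidSpaceTimeDecay g)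
    (h₃ : ∀ t, (h.schedule c₄ hc₄ hc₄').T ≤ t → ∀ x, g t x = 0)
    (h₄ : ∀ k, ∀ t ∈ Icc ((h.schedule c₄ hc₄ hc₄').τ k) ((h.schedule c₄ hc₄ hc₄').τ (k + 1)), ∀ x,
      ‖g t x‖ ≤ c * TowerRates.wide.Y k)
    (hg : ∀ t ∈ Icc 0 ((h.schedule c₄ hc₄ hc₄').τ 0), ∀ x, g t x = (h.schedule c₄ hc₄ hc₄').f t x)
    (hconf : ∀ t x, ρ < ‖x‖ → g t x = 0) (hsilent : ∀ t, Host.τfirst ≤ t → g t = 0)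
    {v : ℝ → EuclideanSpace ℝ (Fin 3) → EuclideanSpace ℝ (Fin 3)}
    {q : ℝ → EuclideanSpace ℝ (Fin 3) → ℝ}
    (hcl : IsClassicalNSSolutionOn (Icc 1 Host.τfirst) 1 g v q) (h1 : v 1 = U)
    (henergy : ∃ C : ℝ≥0∞, C < ⊤ ∧ ∀ t ∈ Icc (1 : ℝ) Host.τfirst, ∫⁻ x, ‖v t x‖ₑ ^ 2 ≤ C)
    (hceil : ∀ t ∈ Icc (1 : ℝ) Host.τfirst, ∀ x, ‖v t x‖ ≤ 5 / 3 * TowerRates.wide.Y 1)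
    (hfloor : ∃ x, ‖x‖ ≤ ρ ∧ TowerRates.wide.Y 1 ≤ ‖v Host.τfirst x‖)
    (hstrain : ∃ x, ‖x‖ ≤ ρ ∧ TowerRates.wide.A 1 ≤ ‖fderiv ℝ (v Host.τfirst) x‖)
    (hcore : ∃ (x : EuclideanSpace ℝ (Fin 3)) (γ : ℝ → EuclideanSpace ℝ (Fin 3)),
      ‖x‖ ≤ ρ ∧ ContDiff ℝ 1 γ ∧ γ 0 = γ 1 ∧
      (∀ s ∈ Icc (0 : ℝ) 1, γ s ∈ Metric.closedBall x (1 / TowerRates.wide.N 1)) ∧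
      (∀ s ∈ Icc (0 : ℝ) 1, ‖deriv γ s‖ ≤ 8 * Real.pi / TowerRates.wide.N 1) ∧
      TowerRates.wide.N 1 ^ (TowerRates.wide.β - 2) ≤ circulation (v Host.τfirst) γ) :
    ∃ (U : EuclideanSpace ℝ (Fin 3) → EuclideanSpace ℝ (Fin 3)) (ρ c₄ : ℝ) (h : LevelZeroData U ρ)
      (hc₄ : 0 < c₄) (hc₄' : c₄ ≤ 1) (c : ℝ) (hc : c ≤ (h.schedule c₄ hc₄ hc₄').c₁)
      (g : ℝ → EuclideanSpace ℝ (Fin 3) → EuclideanSpace ℝ (Fin 3))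
      (h₁ : IsSmoothOnHalfSpace g) (h₂ : HasRapidSpaceTimeDecay g)
      (h₃ : ∀ t, (h.schedule c₄ hc₄ hc₄').T ≤ t → ∀ x, g t x = 0)
      (h₄ : ∀ k, ∀ t ∈ Icc ((h.schedule c₄ hc₄ hc₄').τ k) ((h.schedule c₄ hc₄ hc₄').τ (k + 1)), ∀ x,
        ‖g t x‖ ≤ c * TowerRates.wide.Y k),
      (∀ t ∈ Icc 0 ((h.schedule c₄ hc₄ hc₄').τ 0), ∀ x, g t x = (h.schedule c₄ hc₄ hc₄').f t x) ∧
      (∀ t x, (h.schedule c₄ hc₄ hc₄').radius < ‖x‖ → g t x = 0) ∧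
      (∀ t, (h.schedule c₄ hc₄ hc₄').τ 1 ≤ t → g t = 0) ∧
      ((h.schedule c₄ hc₄ hc₄').repush c hc g h₁ h₂ h₃ h₄).LevelWitness 1 0 := by
  set d : LineGermData U ρ h.width (h.fadeLen hc₄) c₄ := h.lineGermData hc₄ hc₄' with hd
  obtain ⟨s₀⟩ := d.stage
  have hτ0 : d.schedule.τ 0 = 1 := d.schedule_τ_zero
  -- the host's slice at `τ₀ = 1` is the profile `U` (the stage pins the design's flow: forced Serrin–Masuda)
  have hslice : s₀.u 1 = U := by
    have h0 : lineVel U h.width 0 = d.schedule.u₀ := by rw [lineVel_zero]; rfl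
    have key := s₀.velocity_eq_of_classical one_pos (T' := 1) (by rw [hτ0]) d.isClassicalNSSolutionOn_vel
      h0 d.energy_vel
    rw [hτ0] at key
    rw [← key 1 ⟨zero_le_one, le_rfl⟩, lineVel_one]
  refine ⟨U, ρ, c₄, h, hc₄, hc₄', c, hc, g, h₁, h₂, h₃, h₄, hg, hconf, hsilent, ?_⟩
  -- the host transported to the re-pushed schedule, and the slice run glued on
  exact (s₀.repushG c hc g h₁ h₂ h₃ h₄ hg).levelWitness_of_sliceRun one_pos (v := v) (q := q)
    (by
      show IsClassicalNSSolutionOn (Icc (d.schedule.τ 0) (d.schedule.τ 1)) 1 g v q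
      rw [hτ0, d.schedule_τ_one]; exact hcl)
    (by
      show v (d.schedule.τ 0) = s₀.u (d.schedule.τ 0)
      rw [hτ0, h1, hslice])
    (by
      show ∃ C : ℝ≥0∞, C < ⊤ ∧ ∀ t ∈ Icc (d.schedule.τ 0) (d.schedule.τ 1), ∫⁻ x, ‖v t x‖ₑ ^ 2 ≤ C
      rw [hτ0, d.schedule_τ_one]; exact henergy)
    (by
      show ∀ t ∈ Icc (d.schedule.τ 0) (d.schedule.τ 1), ∀ x, ‖v t x‖ ≤ d.schedule.c₂ * TowerRates.wide.Y 1
      rw [hτ0, d.schedule_τ_one, d.schedule_c₂]; exact hceil)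
    (by
      show ∃ x, ‖x‖ ≤ d.schedule.radius ∧ d.schedule.c₁ * TowerRates.wide.Y 1 ≤ ‖v (d.schedule.τ 1) x‖
      rw [d.schedule_τ_one, d.schedule_radius, d.schedule_c₁, one_mul]; exact hfloor)
    (by
      show ∃ x, ‖x‖ ≤ d.schedule.radius ∧
        d.schedule.c₁ * TowerRates.wide.A 1 ≤ ‖fderiv ℝ (v (d.schedule.τ 1)) x‖
      rw [d.schedule_τ_one, d.schedule_radius, d.schedule_c₁, one_mul]; exact hstrain)
    (by
      show ∃ (x : EuclideanSpace ℝ (Fin 3)) (γ : ℝ → EuclideanSpace ℝ (Fin 3)),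
        ‖x‖ ≤ d.schedule.radius ∧ ContDiff ℝ 1 γ ∧ γ 0 = γ 1 ∧
        (∀ s ∈ Icc (0 : ℝ) 1, γ s ∈ Metric.closedBall x (1 / TowerRates.wide.N (0 + 1))) ∧
        (∀ s ∈ Icc (0 : ℝ) 1, ‖deriv γ s‖ ≤ 8 * Real.pi / TowerRates.wide.N (0 + 1)) ∧
        d.schedule.c₁ * TowerRates.wide.N (0 + 1) ^ (TowerRates.wide.β - 2) ≤
          circulation (v (d.schedule.τ (0 + 1))) γ
      rw [zero_add, d.schedule_τ_one, d.schedule_radius, d.schedule_c₁, one_mul]; exact hcore)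

/-- **The unpushed form from ONE SLICE RUN under the germ schedule's own faded force**: a strict-slot filler
`h : Germ.LevelZeroData U ρ`, `c₄ ∈ (0, 1]`, and ONE classical finite-energy solution of Navier–Stokes at unit
viscosity on `[1, Host.τfirst]` forced by `lineForce U h.width (h.fadeLen hc₄)` (the schedule's force: the faded
residual, zero from `1 + h.fadeLen` on) with `v 1 = U`, below `(5/3) Y₁`, with the level-`1` letter ⟹
`∃ …, (h.schedule c₄ …).LevelWitness 1 0` — the hypothesis of `palasekTowerBreakdown_episodeBase_of_exists_slot_levelWitness`
and, via `palasekTowerBreakdown_exists_slot_pushed_of_exists_slot_levelWitness`, the registered stub's statement.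
[cite: Palasek2026ElementaryModel, §4] [cite: Sohr2001, Ch. V Thm. 1.5.1] -/
theorem palasekTowerBreakdown_exists_slot_levelWitness_of_sliceRun (h : LevelZeroData U ρ) {c₄ : ℝ}
    (hc₄ : 0 < c₄) (hc₄' : c₄ ≤ 1)
    {v : ℝ → EuclideanSpace ℝ (Fin 3) → EuclideanSpace ℝ (Fin 3)}
    {q : ℝ → EuclideanSpace ℝ (Fin 3) → ℝ}
    (hcl : IsClassicalNSSolutionOn (Icc 1 Host.τfirst) 1 (lineForce U h.width (h.fadeLen hc₄)) v q)
    (h1 : v 1 = U)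
    (henergy : ∃ C : ℝ≥0∞, C < ⊤ ∧ ∀ t ∈ Icc (1 : ℝ) Host.τfirst, ∫⁻ x, ‖v t x‖ₑ ^ 2 ≤ C)
    (hceil : ∀ t ∈ Icc (1 : ℝ) Host.τfirst, ∀ x, ‖v t x‖ ≤ 5 / 3 * TowerRates.wide.Y 1)
    (hfloor : ∃ x, ‖x‖ ≤ ρ ∧ TowerRates.wide.Y 1 ≤ ‖v Host.τfirst x‖)
    (hstrain : ∃ x, ‖x‖ ≤ ρ ∧ TowerRates.wide.A 1 ≤ ‖fderiv ℝ (v Host.τfirst) x‖)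
    (hcore : ∃ (x : EuclideanSpace ℝ (Fin 3)) (γ : ℝ → EuclideanSpace ℝ (Fin 3)),
      ‖x‖ ≤ ρ ∧ ContDiff ℝ 1 γ ∧ γ 0 = γ 1 ∧
      (∀ s ∈ Icc (0 : ℝ) 1, γ s ∈ Metric.closedBall x (1 / TowerRates.wide.N 1)) ∧
      (∀ s ∈ Icc (0 : ℝ) 1, ‖deriv γ s‖ ≤ 8 * Real.pi / TowerRates.wide.N 1) ∧
      TowerRates.wide.N 1 ^ (TowerRates.wide.β - 2) ≤ circulation (v Host.τfirst) γ) :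
    ∃ (U : EuclideanSpace ℝ (Fin 3) → EuclideanSpace ℝ (Fin 3)) (ρ c₄ : ℝ) (h : LevelZeroData U ρ)
      (hc₄ : 0 < c₄) (hc₄' : c₄ ≤ 1), (h.schedule c₄ hc₄ hc₄').LevelWitness 1 0 := by
  set d : LineGermData U ρ h.width (h.fadeLen hc₄) c₄ := h.lineGermData hc₄ hc₄' with hd
  obtain ⟨s₀⟩ := d.stage
  have hτ0 : d.schedule.τ 0 = 1 := d.schedule_τ_zero
  have hslice : s₀.u 1 = U := by
    have h0 : lineVel U h.width 0 = d.schedule.u₀ := by rw [lineVel_zero]; rfl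
    have key := s₀.velocity_eq_of_classical one_pos (T' := 1) (by rw [hτ0]) d.isClassicalNSSolutionOn_vel
      h0 d.energy_vel
    rw [hτ0] at key
    rw [← key 1 ⟨zero_le_one, le_rfl⟩, lineVel_one]
  refine ⟨U, ρ, c₄, h, hc₄, hc₄', ?_⟩
  exact s₀.levelWitness_of_sliceRun one_pos (v := v) (q := q)
    (by
      show IsClassicalNSSolutionOn (Icc (d.schedule.τ 0) (d.schedule.τ 1)) 1 d.schedule.f v q
      rw [hτ0, d.schedule_τ_one, d.schedule_f]; exact hcl)
    (by
      show v (d.schedule.τ 0) = s₀.u (d.schedule.τ 0)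
      rw [hτ0, h1, hslice])
    (by
      show ∃ C : ℝ≥0∞, C < ⊤ ∧ ∀ t ∈ Icc (d.schedule.τ 0) (d.schedule.τ 1), ∫⁻ x, ‖v t x‖ₑ ^ 2 ≤ C
      rw [hτ0, d.schedule_τ_one]; exact henergy)
    (by
      show ∀ t ∈ Icc (d.schedule.τ 0) (d.schedule.τ 1), ∀ x, ‖v t x‖ ≤ d.schedule.c₂ * TowerRates.wide.Y 1
      rw [hτ0, d.schedule_τ_one, d.schedule_c₂]; exact hceil)
    (by
      show ∃ x, ‖x‖ ≤ d.schedule.radius ∧ d.schedule.c₁ * TowerRates.wide.Y 1 ≤ ‖v (d.schedule.τ 1) x‖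
      rw [d.schedule_τ_one, d.schedule_radius, d.schedule_c₁, one_mul]; exact hfloor)
    (by
      show ∃ x, ‖x‖ ≤ d.schedule.radius ∧
        d.schedule.c₁ * TowerRates.wide.A 1 ≤ ‖fderiv ℝ (v (d.schedule.τ 1)) x‖
      rw [d.schedule_τ_one, d.schedule_radius, d.schedule_c₁, one_mul]; exact hstrain)
    (by
      show ∃ (x : EuclideanSpace ℝ (Fin 3)) (γ : ℝ → EuclideanSpace ℝ (Fin 3)),
        ‖x‖ ≤ d.schedule.radius ∧ ContDiff ℝ 1 γ ∧ γ 0 = γ 1 ∧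
        (∀ s ∈ Icc (0 : ℝ) 1, γ s ∈ Metric.closedBall x (1 / TowerRates.wide.N (0 + 1))) ∧
        (∀ s ∈ Icc (0 : ℝ) 1, ‖deriv γ s‖ ≤ 8 * Real.pi / TowerRates.wide.N (0 + 1)) ∧
        d.schedule.c₁ * TowerRates.wide.N (0 + 1) ^ (TowerRates.wide.β - 2) ≤
          circulation (v (d.schedule.τ (0 + 1))) γ
      rw [zero_add, d.schedule_τ_one, d.schedule_radius, d.schedule_c₁, one_mul]; exact hcore)

end Summit.NavierStokesRegularity.NavierStokesRegularity.Theorems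

end
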